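import Summits.BirchSwinnertonDyer.BirchSwinnertonDyer.Theorems.OneSidedTwistSqueezeX9KatoDivisibilityX9KolyvaginReciprocityPkPackage
import Summits.BirchSwinnertonDyer.BirchSwinnertonDyer.Theorems.OneSidedTwistSqueezeX9KatoDivisibilityX9KolyvaginReciprocityPkAssemblyPrelims
import HarnessLib

set_option autoImplicit false

-- the summit and its single problem are both named `BirchSwinnertonDyer` (registry layout D-0017)
set_option linter.dupNamespace false

/-!
# Crux `KatoDivisibilityX9` (stmt-BirchSwinnertonDyer-20547), line `graded_euler_loss`, stub `stub_reciprocityPkAX9`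
# (hG34ᵍ): the hypothesis `hKolyRecPk` of `…StubReciprocityPkAX9Assembly.stub_reciprocityPkAX9_of_kolyvaginReciprocityPk`
# (p631775) FROM ONE LOCAL HYPOTHESIS `hLocalPk` — the level-`p^k` twin of koly's
# `LocalSplitPrime.convCoeff_eq_zero_of_transverse_of_unramified` (Poitou–Tate + the `q`-term identity for
# `𝒯_J^{(k)}`, item (M3)); the GLOBAL half (items (M1)+(M2): the genuine Euler system's Kolyvagin cocycle at level
# `p^{d+1}` with its value, `exists_kolyvaginPackagePk`) is DISCHARGED

Seat `bsd-line-k6-p4` (prover-bsd-line-k6-p4-g5-0, wave-2 stub worker B).  THEOREMS ONLY (no definition, no named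
fact, no `sorry`); nothing is asserted about any curve; `--supports stmt-BirchSwinnertonDyer-20547 --as helper`.
`kolyvaginReciprocityPk_of_localPk (hLocalPk) : <hKolyRecPk VERBATIM>` — the graded twin of lur-b's
`StepsTwoFour.stub_stepsTwoFourOdd_of` with its `hKoly` discharged (koly `exists_kolyvaginPackage`) and its STEP 4
(koly `LocalSplitPrime.convCoeff_eq_zero_of_transverse_of_unramified`) kept as the hypothesis: at level `p^k` that
local theorem is not in the tree (its ingredients `exists_unit_qTermIdentity`, `StepFour.convCoeff_eq_zero_of_qTermIdentity`,
`LocalQTerm*`, `LocalSplitValues`, `StepFourFinal/CocycleSeams` exist for `twistModP` only; T6d's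
`twistContPairingPk`/`twistDualMapPk`, `LocalInvariants K n`, `LocalTransverse*`, `PairingUniqueness` are level-free).

THE HYPOTHESIS `hLocalPk` = koly's theorem with `twistModP ↦ twistModPk`, `p ↦ p^k` in `MuCarrier`, `ZMod`,
`LocalInvariants`, `hM`, `hpl`, `shiftH1 ↦ shiftH1Pk` (universe `0`), AND the extra level hypothesis `J = 2p^m k`
(the level of the graded core; there `X^J = m·ω² (mod p^k)`, `ω = (X+1)^{p^m} − 1`, so the transverse values
`𝒯_J^{φ̃=1} = ker ω(S)` are `(mω)(S)·𝒯_J` — the parametrisation replacing the mod-`p` `T^{J−p^m}𝒯_J`).  THE ASSEMBLY: the exceptional set is that of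
`exists_kolyvaginPackagePk` plus x9's sets where `E[p]`, `E[p^{d+1}]` are unramified, `v ∤ p`, good reduction; at `q`:
`p^{d+1} ∣ N(q) − 1` (file `…EulerFactor`), `χ̄_{N q}` onto on inertia, the `primesEquiv`/`absNorm` seams, the
level-`p^{d+1}` pairing in koly's currency (file `…AssemblyPrelims`), Poitou–Tate at `n = p^{d+1}`, the `T^ε`-condition
rewritten through `shiftH1Pk_iterate_eq_map_shiftEmbed_truncate`; then `hLocalPk` at `(c, τq, r)` and the package's VALUE
`c(res τq) = V(S)·φ(res r)`.

HONEST LABEL: `hLocalPk` is OPEN in the tree (item (M3)); the registered stub `stub_reciprocityPkAX9` stays OPEN; this file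
closes nothing; crux 20547 / B2 untouched; beyond-print theorem toward BSD: NO.

References: B. Mazur, K. Rubin, Mem. AMS 799 (2004) Prop. 1.3.2, §4.4, §5.3 [MazurRubin2004]; K. Kato, Astérisque 295
(2004) §13 [Kato2004Asterisque]; J. S. Milne, ADT I Thm. 4.10 [MilneADT2006]; J. H. Silverman, AEC III.8
[SilvermanAEC2009]; HOME/MEMO-es.md §15 STEPS 3–4.
-/

noncomputable section

open scoped NumberField ContRepresentation
open Polynomial Field IsDedekindDomain NumberField
open Literature.NumberTheory.GaloisRepresentations
open Literature.NumberTheory.GaloisRepresentations.IsNonarchimedeanLocalField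
open Literature.NumberTheory.GaloisCohomology
open Literature.NumberTheory.EllipticCurves
open Literature.NumberTheory.EllipticCurves.ZpExtension
open Literature.NumberTheory.EllipticCurves.Kato2004
open Literature.NumberTheory.EllipticCurves.Kato2004.EulerSystemValues
open Rat.HeightOneSpectrum
open WeierstrassCurve (geomPoints geomTorsion galoisRepTorsion)
open Summit.BirchSwinnertonDyer.Rank1Residual.GaloisImage
open Summit.BirchSwinnertonDyer.BirchSwinnertonDyer.Rank1Residual
open Summit.BirchSwinnertonDyer.BirchSwinnertonDyer.Theorems.OneSidedTwistSqueezeX9KatoDivisibilityX9StubReciprocityPkX9Local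
open Summit.BirchSwinnertonDyer.BirchSwinnertonDyer.Theorems.OneSidedTwistSqueezeX9KatoDivisibilityX9StubReciprocityPkX9Pairing
open Summit.BirchSwinnertonDyer.BirchSwinnertonDyer.Theorems.OneSidedTwistSqueezeX9KatoDivisibilityX9KolyvaginReciprocityPkEulerFactor
open Summit.BirchSwinnertonDyer.BirchSwinnertonDyer.Theorems.OneSidedTwistSqueezeX9KatoDivisibilityX9KolyvaginReciprocityPkPackage
open Summit.BirchSwinnertonDyer.BirchSwinnertonDyer.Theorems.OneSidedTwistSqueezeX9KatoDivisibilityX9KolyvaginReciprocityPkAssemblyPrelims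

namespace Summit.BirchSwinnertonDyer.BirchSwinnertonDyer.Theorems.OneSidedTwistSqueezeX9KatoDivisibilityX9KolyvaginReciprocityPkOfLocal

-- heartbeat head-room for the two long statements and the long context; own budget line
set_option maxHeartbeats 800000 in
/-- **`hKolyRecPk` from the level-`p^k` local vanishing theorem `hLocalPk`** (module docstring): the global half —
Kato's Euler system ⟶ the level-`p^{d+1}` Kolyvagin cocycle with its value (`exists_kolyvaginPackagePk`) — is proved;
the local half (Poitou–Tate for `𝒯 × 𝒯(κ⁻¹) → μ_{p^{d+1}}` + the level-`p^{d+1}` `q`-term identity) enters as the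
hypothesis, stated as the verbatim level-`p^k` twin of koly's `LocalSplitPrime.convCoeff_eq_zero_of_transverse_of_unramified`.
[cite: MazurRubin2004, Prop. 1.3.2, §4.4 and §5.3] [cite: Kato2004Asterisque, §13.3 and Thm. 13.4 (p. 226)]
[cite: MilneADT2006, Ch. I, Thm. 4.10(b)] -/
theorem kolyvaginReciprocityPk_of_localPk
    (hLocalPk : ∀ {K : Type} [Field K] [NumberField K] {p : ℕ} [Fact p.Prime] {k : ℕ}
      {M M' : Type} [AddCommGroup M] [TopologicalSpace M] [DiscreteTopology M] [Finite M]
      [AddCommGroup M'] [TopologicalSpace M'] [DiscreteTopology M'] [Finite M']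
      (ρ : DiscreteGaloisModule K M) (ρ' : DiscreteGaloisModule K M')
      (hM : ∀ x : M, p ^ k • x = 0) (hM' : ∀ x : M', p ^ k • x = 0) (κ : ZpExtension K p) (J : ℕ)
      (q : HeightOneSpectrum (𝓞 K)) [Fact (Ideal.absNorm q.asIdeal).Prime]
      [NeZero ((Ideal.absNorm q.asIdeal : ℕ) : q.adicCompletion K)]
      [LocallyCompactSpace (absoluteGaloisGroup K)]
      [LocallyCompactSpace (absoluteGaloisGroup (Place.Completion (Sum.inr q : Place K)))],
      p ≠ 2 →
      ∀ {e : M →+ M' →+ DiscreteGaloisModule.MuCarrier K (p ^ k)},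
      (∀ (g : absoluteGaloisGroup K) (a : M) (b : M'),
        e (ρ g a) (ρ' g b) = DiscreteGaloisModule.mu K (p ^ k) g (e a b)) →
      (∀ b : M', (∀ a : M, e a b = 0) → b = 0) →
      (∀ χ : M →+ DiscreteGaloisModule.MuCarrier K (p ^ k), ∃ b : M', ∀ a, e a b = χ a) →
      ∀ (ι : DiscreteGaloisModule.MuCarrier K (p ^ k) →+ ZMod (p ^ k)), Function.Injective ι →
      ∀ {v₀ : M} {w₀ : M'}, ι (e v₀ w₀) = 1 →
      ∀ {inv : LocalInvariants K (p ^ k)}, inv.IsPerfect → inv.SumLocalTermEqZero →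
      ∀ (S : Set (HeightOneSpectrum (𝓞 K))), q ∉ S →
      (∀ v ∉ S, ((p : ℕ) : 𝓞 K) ∉ v.asIdeal) → (∀ v ∉ S, GaloisRep.IsUnramifiedAt v ρ) →
      GaloisRep.IsUnramifiedAt q ρ' → p ^ k ∣ Ideal.absNorm q.asIdeal - 1 →
      (∀ u : (ZMod (Ideal.absNorm q.asIdeal))ˣ, ∃ t ∈ absInertia (q.adicCompletion K),
        modPCyclotomicCharacterZMod (q.adicCompletion K) (Ideal.absNorm q.asIdeal) t = u) →
      ∀ {Fr : absoluteGaloisGroup (q.adicCompletion K)}, IsAbsArithFrob Fr →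
      ρ (absGaloisRestrict K (q.adicCompletion K) Fr) = 1 →
      ρ' (absGaloisRestrict K (q.adicCompletion K) Fr) = 1 →
      ∀ {m : ℕ}, m + 1 ≤ J → J = 2 * p ^ m * k →
      absGaloisRestrict K (q.adicCompletion K) Fr ∈ κ.layerSubgroup m →
      absGaloisRestrict K (q.adicCompletion K) Fr ∉ κ.layerSubgroup (m + 1) →
      ∀ {t₀ : absoluteGaloisGroup (q.adicCompletion K)}, t₀ ∈ absInertia (q.adicCompletion K) →
      (∀ u : (ZMod (Ideal.absNorm q.asIdeal))ˣ,
        u ∈ Subgroup.zpowers (modPCyclotomicCharacterZMod (q.adicCompletion K) (Ideal.absNorm q.asIdeal) t₀)) →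
      ∀ (c : contOneCocycles (κ.twistModPk ρ hM J).toTopRep),
      (∀ v ∉ S, v ≠ q → galoisCohomology.localization (κ.twistModPk ρ hM J) (Sum.inr v) 1
          (oneCocycleClass (κ.twistModPk ρ hM J).toTopRep c) ∈
        DiscreteGaloisModule.unramifiedSubgroup (GaloisRep.toLocal v (κ.twistModPk ρ hM J)) 1) →
      galoisCohomology.localization (κ.twistModPk ρ hM J) (Sum.inr q) 1
          (oneCocycleClass (κ.twistModPk ρ hM J).toTopRep c) ∈
        DiscreteGaloisModule.transverseSubgroup (GaloisRep.toLocal q (κ.twistModPk ρ hM J))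
          (CyclotomicField (Ideal.absNorm q.asIdeal) (q.adicCompletion K)) →
      ∀ (Ψc : contOneCocycles (κ.invTwist.twistModPk ρ' hM' J).toTopRep),
      (∀ v ∉ S, galoisCohomology.localization (κ.invTwist.twistModPk ρ' hM' J) (Sum.inr v) 1
          (oneCocycleClass (κ.invTwist.twistModPk ρ' hM' J).toTopRep Ψc) ∈
        DiscreteGaloisModule.unramifiedSubgroup (GaloisRep.toLocal v (κ.invTwist.twistModPk ρ' hM' J)) 1) →
      ∀ (ε : ℕ),
      (∀ v ∈ S, galoisCohomology.localization (κ.invTwist.twistModPk ρ' hM' J) (Sum.inr v) 1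
        ((κ.invTwist.shiftH1Pk ρ' hM' J)^[ε] (oneCocycleClass (κ.invTwist.twistModPk ρ' hM' J).toTopRep Ψc)) = 0) →
      ∀ i, i + ε < J → convCoeff e J i (c.1 (absGaloisRestrict K (q.adicCompletion K) t₀))
        (Ψc.1 (absGaloisRestrict K (q.adicCompletion K) Fr)) = 0) :
    ∀ (W : WeierstrassCurve ℚ) [W.IsElliptic] [W.IsGloballyMinimal] (p : ℕ) [Fact p.Prime]
      [ContinuousSMul ℤ_[p] (W.tateModule p)] [Module.Free ℤ_[p] (W.tateModule p)]
      [Module.Finite ℤ_[p] (W.tateModule p)]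
      (κ : ZpExtension ℚ p) (γ : absoluteGaloisGroup ℚ) (I : IwasawaH1Data W p κ γ),
      p ≠ 2 → W.HasIrreducibleModPGaloisRep p → ¬ W.HasSurjectiveModNGaloisRep p →
      κ.IsCyclotomic → κ.IsTopGenerator γ →
      poitouTate_sum_localTatePairing_eq_zero ℚ →
      ∀ (s : I.H), IsEulerSystemClass W p κ γ I s → ∀ (d : ℕ),
      ∃ (S₀ : Set (HeightOneSpectrum (𝓞 ℚ))), S₀.Finite ∧
      ∀ (N e' : ℕ), e' + 1 = p ^ N → d ≤ N →
      ∀ (J : ℕ), J + 1 = (2 * e' + 1 + 1) * (d + 1) →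
      ∀ (φ : contOneCocycles (W.modPkTwist p (d + 1) κ (J + 1)).toTopRep),
      oneCocycleClass (W.modPkTwist p (d + 1) κ (J + 1)).toTopRep φ = (I.redTowerPk (d + 1) s).1 (J + 1) →
      ∀ (ε : ℕ) (S₁ : Set (HeightOneSpectrum (𝓞 ℚ))), S₀ ⊆ S₁ →
      ∀ (Ψ : galoisCohomology (W.modPkTwist p (d + 1) κ.invTwist (J + 1)) 1)
      (Ψc : contOneCocycles (W.modPkTwist p (d + 1) κ.invTwist (J + 1)).toTopRep),
      oneCocycleClass (W.modPkTwist p (d + 1) κ.invTwist (J + 1)).toTopRep Ψc = Ψ →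
      (∀ v : HeightOneSpectrum (𝓞 ℚ), v ∉ S₁ →
      galoisCohomology.localization (W.modPkTwist p (d + 1) κ.invTwist (J + 1)) (Sum.inr v) 1 Ψ ∈
      DiscreteGaloisModule.unramifiedSubgroup
      (GaloisRep.toLocal v (W.modPkTwist p (d + 1) κ.invTwist (J + 1))) 1) →
      (∀ v : HeightOneSpectrum (𝓞 ℚ), v ∈ S₁ →
      galoisCohomology.localization (W.modPkTwist p (d + 1) κ.invTwist (J + 1)) (Sum.inr v) 1
      (galoisCohomology.map
      (κ.invTwist.twistModPkShiftEmbed (W.torsionGaloisModule ((p : ℤ) ^ (d + 1)))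
      (W.pow_nsmul_geomTorsion_eq_zero p (d + 1)) (J + 1) (Nat.sub_le (J + 1) ε)) 1
      (galoisCohomology.map
      (κ.invTwist.twistModPkTruncate (W.torsionGaloisModule ((p : ℤ) ^ (d + 1)))
      (W.pow_nsmul_geomTorsion_eq_zero p (d + 1)) (J + 1) (Nat.sub_le (J + 1) ε)) 1 Ψ)) = 0) →
      ∀ (ek : geomTorsion W ((p : ℤ) ^ (d + 1)) →+ geomTorsion W ((p : ℤ) ^ (d + 1)) →+
      DiscreteGaloisModule.MuCarrier ℚ (p ^ (d + 1))),
      (∀ (σ : absoluteGaloisGroup ℚ) (S T : geomTorsion W ((p : ℤ) ^ (d + 1))),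
      ek (σ • S) (σ • T) = DiscreteGaloisModule.mu ℚ (p ^ (d + 1)) σ (ek S T)) →
      (∀ T, ek T T = 0) → (∀ T, (∀ S, ek S T = 0) → T = 0) →
      ∀ (q : HeightOneSpectrum (𝓞 ℚ)), q ∉ S₁ →
      ∀ 𝔓 ∈ q.primesAbove, ∀ (Fr : absoluteGaloisGroup ℚ), IsArithFrobAt (𝓞 ℚ) Fr 𝔓 →
      galoisRepTorsion W ((p : ℤ) ^ (d + 1)) Fr = 1 →
      Fr ∈ κ.layerSubgroup N → Fr ∉ κ.layerSubgroup (N + 1) →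
      ∃ (r : absoluteGaloisGroup (q.adicCompletion ℚ)), IsAbsArithFrob r ∧
      ∃ (V U : Polynomial ℤ), ¬ ((p : ℤ) ∣ U.coeff 0) ∧
      (∀ i : ℕ, i < J + 1 →
      (p : ℤ) ^ (d + 1) ∣ (V * ((Polynomial.X + 1 : Polynomial ℤ) ^ (e' + 1) - 1)).coeff i) ∧
      (∀ i : ℕ, i < J + 1 → (p : ℤ) ∣ (V - U * Polynomial.X ^ (J + 1 - (e' + 1))).coeff i) ∧
      ∀ i : ℕ, i + ε < J + 1 →
      convCoeff ek (J + 1) i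
      (Polynomial.aeval (shiftEnd (geomTorsion W ((p : ℤ) ^ (d + 1))) (J + 1)) V
      (φ.1 (absGaloisRestrict ℚ (q.adicCompletion ℚ) r)))
      (Ψc.1 (absGaloisRestrict ℚ (q.adicCompletion ℚ) r)) = 0 := by
  intro W _ _ p _ _ _ _ κ γ I hp2 hirr _ _ _ hPTfact s hES d
  have hp : p.Prime := Fact.out
  haveI : NeZero p := ⟨hp.ne_zero⟩
  -- the package's exceptional set and x9's sets (off them: `v ∤ p`, good reduction, `E[p]` / `E[p^{d+1}]` unramified)
  obtain ⟨S₀', hS₀'fin, hK⟩ := exists_kolyvaginPackagePk W p d κ γ I hp2 hirr hES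
  obtain ⟨S₁', hS₁'fin, hS₁'⟩ :=
    TorsionUnramified.exists_finite_isUnramifiedAt_torsionGaloisModule W (K := ℚ) (p := p) hp.ne_zero
  obtain ⟨S₂', hS₂'fin, hS₂'⟩ :=
    TorsionUnramified.exists_finite_isUnramifiedAt_torsionGaloisModule W (K := ℚ) (p := p ^ (d + 1))
      (pow_ne_zero _ hp.ne_zero)
  refine ⟨S₀' ∪ (S₁' ∪ S₂'), hS₀'fin.union (hS₁'fin.union hS₂'fin), ?_⟩
  intro N e' he' hdN J hJ φ hφ ε S₁ hS₀₁ Ψ Ψc hΨc hΨur hΨS ek hek_gal hek_alt hek_nd q hq 𝔓 h𝔓 Fr hFr hFr1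
    hFrN hFrN1
  have hq' : q ∉ S₀' := fun h => hq (hS₀₁ (Or.inl h))
  have hoff : ∀ v ∉ S₁, ((p : ℕ) : 𝓞 ℚ) ∉ v.asIdeal ∧ W.HasGoodReductionAt v ∧
      GaloisRep.IsUnramifiedAt v (W.torsionGaloisModule (p : ℤ)) :=
    fun v hv => hS₁' v fun h => hv (hS₀₁ (Or.inr (Or.inl h)))
  have hoffk : ∀ v ∉ S₁, GaloisRep.IsUnramifiedAt v (W.torsionGaloisModule ((p : ℤ) ^ (d + 1))) := fun v hv => by
    have h := (hS₂' v fun h => hv (hS₀₁ (Or.inr (Or.inr h)))).2.2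
    rwa [Nat.cast_pow] at h
  obtain ⟨hqp, hgood, -⟩ := hoff q hq
  have hurk := hoffk q hq
  -- the prime `ℓ` of `q`, instances at `q`
  haveI : NeZero ((primesEquiv q : Nat.Primes) : ℕ) := ⟨(primesEquiv q).2.ne_zero⟩
  haveI : Fact (((primesEquiv q : Nat.Primes) : ℕ)).Prime := ⟨(primesEquiv q).2⟩
  haveI : NeZero ((((primesEquiv q : Nat.Primes) : ℕ) : ℕ) : q.adicCompletion ℚ) := by
    haveI := charZero_adicCompletion q; exact NeZero.charZero
  haveI hNn : (rootsOfUnityFixer ℚ ((primesEquiv q : Nat.Primes) : ℕ)).Normal :=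
    KolyvaginTwist.normal_rootsOfUnityFixer _
  haveI : CompactSpace (absoluteGaloisGroup ℚ) := absoluteGaloisGroup_compactSpace ℚ
  haveI : (rootsOfUnityFixer ℚ ((primesEquiv q : Nat.Primes) : ℕ)).FiniteIndex :=
    finiteIndex_of_isOpen_of_compactSpace _ (isOpen_rootsOfUnityFixer ℚ _)
  haveI : Fintype (absoluteGaloisGroup ℚ ⧸ rootsOfUnityFixer ℚ ((primesEquiv q : Nat.Primes) : ℕ)) :=
    Fintype.ofFinite _
  have hℓabs : Ideal.absNorm q.asIdeal = ((primesEquiv q : Nat.Primes) : ℕ) :=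
    Literature.NumberTheory.LFunctions.absNorm_asIdeal_eq_primesEquiv q
  haveI : Fact (Ideal.absNorm q.asIdeal).Prime := ⟨by rw [hℓabs]; exact (primesEquiv q).2⟩
  haveI : NeZero ((Ideal.absNorm q.asIdeal : ℕ) : q.adicCompletion ℚ) :=
    ⟨by rw [hℓabs]; exact NeZero.ne _⟩
  haveI : LocallyCompactSpace (absoluteGaloisGroup ℚ) := inferInstance
  haveI : CompactSpace (absoluteGaloisGroup (q.adicCompletion ℚ)) :=
    absoluteGaloisGroup_compactSpace (q.adicCompletion ℚ)
  haveI : LocallyCompactSpace (absoluteGaloisGroup (Place.Completion (Sum.inr q : Place ℚ))) :=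
    (inferInstance : LocallyCompactSpace (absoluteGaloisGroup (q.adicCompletion ℚ)))
  haveI : Finite (geomTorsion W ((p : ℤ) ^ (d + 1))) := finite_geomTorsion_pow W p (d + 1)
  -- the Kolyvagin package at `q`
  obtain ⟨c, τq, r, hτq, hgen, hx, hcq, hr, V, U, hU0, hVω, hVU, hval⟩ :=
    hK N e' he' J hJ φ hφ q hq' 𝔓 h𝔓 Fr hFr hFr1 hFrN hFrN1
  -- `E[p^{d+1}]`-splitness and depth of the local Frobenius `r`
  obtain ⟨hρkr, hrN, hrN1⟩ := StepsTwoFourTransport.isSplit_and_depth_absGaloisRestrict_of_isArithFrobAt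
    (W.torsionGaloisModule ((p : ℤ) ^ (d + 1))) κ hurk hqp h𝔓 hFr
    (torsionGaloisModule_eq_one_of_galoisRepTorsion_eq_one W hFr1) hFrN hFrN1 hr
  -- `p^{d+1} ∣ N(q) − 1`, `χ̄_{N q}` onto on inertia, `hgen` and `hcq` in the `absNorm` currency
  have hne : ((primesEquiv q : Nat.Primes) : ℕ) ≠ p := TameClass.primesEquiv_ne_of_natCast_not_mem hqp
  obtain ⟨hq1, -⟩ :=
    natCast_eq_one_and_frobeniusTrace_eq_two_of_galoisRepTorsion_pow_eq_one W p d hne hgood ⟨𝔓, h𝔓, hFr⟩ hFr1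
  have hpl : p ^ (d + 1) ∣ Ideal.absNorm q.asIdeal - 1 := by
    rw [hℓabs]; exact pow_dvd_primesEquiv_sub_one_of_natCast_eq_one p d hq1
  have hχI : ∀ u : (ZMod (Ideal.absNorm q.asIdeal))ˣ, ∃ t ∈ absInertia (q.adicCompletion ℚ),
      modPCyclotomicCharacterZMod (q.adicCompletion ℚ) (Ideal.absNorm q.asIdeal) t = u := fun u =>
    Rat.exists_mem_absInertia_adicCompletion_modPCyclotomicCharacterZMod_eq_of_absNorm_eq q rfl u
  have hgen' : ∀ u : (ZMod (Ideal.absNorm q.asIdeal))ˣ,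
      u ∈ Subgroup.zpowers (modPCyclotomicCharacterZMod (q.adicCompletion ℚ) (Ideal.absNorm q.asIdeal) τq) := by
    have key : ∀ (m : ℕ) [Fact m.Prime] [NeZero ((m : ℕ) : q.adicCompletion ℚ)],
        m = ((primesEquiv q : Nat.Primes) : ℕ) →
        ∀ u : (ZMod m)ˣ, u ∈ Subgroup.zpowers (modPCyclotomicCharacterZMod (q.adicCompletion ℚ) m τq) := by
      intro m _ _ hm; subst hm; exact hgen
    exact key _ hℓabs
  have hcq' := (TameSeams.mem_transverseSubgroup_cyclotomicField_absNorm_iff q _ _).2 hcq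
  -- the pairing `ek` in koly's currency, Poitou–Tate at `n = p^{d+1}`
  have he : ∀ (g : absoluteGaloisGroup ℚ) (a b : geomTorsion W ((p : ℤ) ^ (d + 1))),
      ek (W.torsionGaloisModule ((p : ℤ) ^ (d + 1)) g a) (W.torsionGaloisModule ((p : ℤ) ^ (d + 1)) g b) =
        DiscreteGaloisModule.mu ℚ (p ^ (d + 1)) g (ek a b) := fun g a b => by
    rw [WeierstrassCurve.torsionGaloisModule_apply_apply, WeierstrassCurve.torsionGaloisModule_apply_apply]
    exact hek_gal g a b
  have hsurj := right_surjective_of_nondegenerate W p d ek hek_nd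
  obtain ⟨ι, v₀, w₀, hι, h1⟩ := exists_iota_apply_eq_one W p d ek hek_alt hek_nd
  haveI : NeZero (p ^ (d + 1)) := ⟨pow_ne_zero _ hp.ne_zero⟩
  obtain ⟨inv, hperf, hPT⟩ := hPTfact (p ^ (d + 1))
  -- the Selmer-side clauses of `Ψ = [Ψc]`, the clause `hx` of `c`
  have hΨ : ∀ v ∉ S₁, galoisCohomology.localization (W.modPkTwist p (d + 1) κ.invTwist (J + 1)) (Sum.inr v) 1
      (oneCocycleClass (W.modPkTwist p (d + 1) κ.invTwist (J + 1)).toTopRep Ψc) ∈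
      DiscreteGaloisModule.unramifiedSubgroup
        (GaloisRep.toLocal v (W.modPkTwist p (d + 1) κ.invTwist (J + 1))) 1 := fun v hv => by
    rw [hΨc]; exact hΨur v hv
  have hΨS' : ∀ v ∈ S₁, galoisCohomology.localization (W.modPkTwist p (d + 1) κ.invTwist (J + 1)) (Sum.inr v) 1
      ((κ.invTwist.shiftH1Pk (W.torsionGaloisModule ((p : ℤ) ^ (d + 1)))
        (W.pow_nsmul_geomTorsion_eq_zero p (d + 1)) (J + 1))^[ε]
        (oneCocycleClass (W.modPkTwist p (d + 1) κ.invTwist (J + 1)).toTopRep Ψc)) = 0 := fun v hv => by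
    rw [hΨc, shiftH1Pk_iterate_eq_map_shiftEmbed_truncate]
    exact hΨS v hv
  have hxS : ∀ v ∉ S₁, v ≠ q → galoisCohomology.localization (W.modPkTwist p (d + 1) κ (J + 1)) (Sum.inr v) 1
      (oneCocycleClass (W.modPkTwist p (d + 1) κ (J + 1)).toTopRep c) ∈
      DiscreteGaloisModule.unramifiedSubgroup (GaloisRep.toLocal v (W.modPkTwist p (d + 1) κ (J + 1))) 1 :=
    fun v hv hvq => hx v hvq (hoff v hv).1 (hoffk v hv)
  -- depth bookkeeping: `N + 1 ≤ L`
  have hNJ : N + 1 ≤ J + 1 := by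
    have h1 := Nat.lt_pow_self hp.one_lt (n := N)
    have h2 : 2 * e' + 1 + 1 ≤ J + 1 := by rw [hJ]; exact Nat.le_mul_of_pos_right _ (Nat.succ_pos d)
    omega
  have hJL : J + 1 = 2 * p ^ N * (d + 1) := by rw [hJ, ← he']; ring
  -- STEP 4 at level `p^{d+1}` (the hypothesis) at `(c, τq, r)`
  have h4 : ∀ i, i + ε < J + 1 →
      convCoeff ek (J + 1) i (c.1 (absGaloisRestrict ℚ (q.adicCompletion ℚ) τq))
        (Ψc.1 (absGaloisRestrict ℚ (q.adicCompletion ℚ) r)) = 0 := by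
    unfold WeierstrassCurve.modPkTwist at Ψc hΨ hΨS' hxS
    exact hLocalPk (W.torsionGaloisModule ((p : ℤ) ^ (d + 1))) (W.torsionGaloisModule ((p : ℤ) ^ (d + 1)))
      (W.pow_nsmul_geomTorsion_eq_zero p (d + 1)) (W.pow_nsmul_geomTorsion_eq_zero p (d + 1)) κ (J + 1) q hp2
      he hek_nd hsurj ι hι h1 hperf hPT S₁ hq (fun v hv => (hoff v hv).1) hoffk hurk hpl hχI hr hρkr hρkr hNJ hJL
      hrN hrN1 hτq hgen' c hxS hcq' Ψc hΨ ε hΨS'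
  refine ⟨r, hr, V, U, hU0, hVω, hVU, fun i hi => ?_⟩
  rw [← hval]
  exact h4 i hi

end Summit.BirchSwinnertonDyer.BirchSwinnertonDyer.Theorems.OneSidedTwistSqueezeX9KatoDivisibilityX9KolyvaginReciprocityPkOfLocal

end
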